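/-
Copyright (c) 2026 the pub-hodgecm-mathlib formalisation cell (harness21).  Prover seat hodgecm-mathlib-F0P3a-p01 (g19): line LH1 (chair LH1-plan (g4)),
ED. 4 «Kompakt» brick (K1) «KOMPAKT-GLUE»; 2026-09-02.
-/
import Summits.HodgeConjecture.HodgeConjecture.Theorems.F0P3cXiCentralAllPlaces   -- ★ p850069 (LH1-p01 (g4)): central exponent at every `τ`, residue arithmetic mod O-SPLIT
import Summits.HodgeConjecture.HodgeConjecture.Theorems.F0P3cXiCentralCharSplit   -- ★ p850109 (this seat): O-SPLIT `xiCentralCharSplit`, discharging the `hS` of ★ p850069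
import HarnessLib

/-!
# F0 · P3c · line LH1 — ED. 4 «Kompakt» glue (K1): PIN-τ ⟺ CASIMIR-τ (the compact-place pin of #80 reduced to the print residue `qψ τ = ±1`)

Cell `pub/hodgecm-mathlib`, crux H413 = `stmt-HodgeConjecture-24833` (`--supports` lane), route HCCMUnconditional; prover F0P3a-p01 (g19) on LH1-plan (g4)'s
by-name deal «(K1) KOMPAKT-GLUE» 2026-09-02T07:19Z.  Closed-`Prop` letters + theorems (no instance, no notation, no `sorry`); the two letters carry PROSE
locators (gate relocation rule for `def … : Prop` under `Theorems/`).

LETTERS (frame = the PIN-τ organ of the LH1 leaf `Cruxes/H413/Lines/F0_P3c_S2SharpPaydown.lean` ED. 2, restated byte-for-byte — a `Theorems` file never imports a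
`Lines` leaf):
* `S2PinCompactLetter` — organ PIN-τ VERBATIM: a hol∕antihol cotangent `P` of the inner form `U(H)` on which the compact factor `K_c` acts trivially, in the ξ-family,
  has `ξ` of cohomological type with trivial coefficients (★ `OneDimAutRepH.IsCohTrivialAt`) at every embedding `τ` NOT over the place of `ι`.
* `S2CasimirTauLetter` — the SAME binders with the conclusion «the Rogawski triple `(a,b,c) = rogTriple (pη τ) (qψ τ) t_τ` has `a² + b² + c² = 2`» at every `τ ≠ ι`
  (the Casimir∕infinitesimal-character norm at the compact places — the honest print residue, = «`qψ τ = ±1`», packet rigidity [Rogawski1990, Thm. 13.3.5, Thm. 14.6.4]).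
THEOREMS: `pinCompact_of_casimirTau`, `casimirTau_of_pinCompact`, `pinCompact_iff_casimirTau` — both directions over ★ p850069's residue arithmetic
(`sq_sum_eq_two_iff_qψ_of_split`, `isCohTrivialAt_of_split_of_qψ`, `isCohTrivialAt_iff_qψ_of_split`) with its O-SPLIT hypothesis `hS` DISCHARGED by ★ p850109
`F0P3cXiCentralCharSplit.xiCentralCharSplit`; the CENTRAL half (`a + b + c = 0` at every `τ`, ★ `centralSum_eq_zero_at_of_split`) is thereby unconditional
(`centralSum_eq_zero_at_of_split xiCentralCharSplit …`), so PIN-τ and CASIMIR-τ differ from each other by nothing and from print by exactly «`qψ τ = ±1`».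
With (K1) ★ the LH1 leaf's ED. 4 «Kompakt» is a pure re-assembly: `stub_S2pinCompact ↦ pinCompact_of_casimirTau stub_S2casimirTau`.
HONEST LABEL: HC_CM is proved only modulo the 2 remaining named inputs (hLiu418 24832, h413 24833) until rung 0 closes; count-neutral (no books digit moves; #80 stays
one UNPROVED row until FIN · CASIMIR-ι · CASIMIR-τ∕PIN-τ are ★).

## References
* [Rogawski1990] J. Rogawski, *Automorphic Representations of Unitary Groups in Three Variables*, Ann. of Math. Stud. 123 (1990), §12.3 pp. 174–178 (p. 176 `F_φ`,
  p. 178), Thm. 13.3.5 (p. 202), §14.6 pp. 242–243 and Thm. 14.6.4 (p. 243).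
* [BorelWallach2000] A. Borel, N. Wallach, *Continuous cohomology, discrete subgroups, and representations of reductive groups*, 2nd ed. (2000), II Prop. 6.12.
* [Liu2021] Y. Liu, Camb. J. Math. 9 (2021), Remark 4.2.
-/

set_option autoImplicit false
-- the mandated namespace has the single-problem summit's repeated segment (`HodgeConjecture.HodgeConjecture`)
set_option linter.dupNamespace false

noncomputable section

open NumberField IsDedekindDomain MeasureTheory
open scoped Matrix ComplexOrder

namespace Summit.HodgeConjecture.HodgeConjecture.Cruxes.H413.F0P3cPinCompactChi

open Literature.NumberTheory.Automorphic Literature.NumberTheory.Automorphic.UnitaryGroup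
open Literature.NumberTheory.Automorphic.UnitaryGroup.CotangentForms
open Literature.NumberTheory.Automorphic.Arthur2013.Leaves.TECR
open Literature.NumberTheory.GaloisRepresentations
open Literature.NumberTheory.Rogawski1990
open Summit.HodgeConjecture.HodgeConjecture.Cruxes.H413.F0P3XiArchDataOfRecord
open Summit.HodgeConjecture.HodgeConjecture.Cruxes.H413.F0P3cRogTripleChiArithmetic
open Summit.HodgeConjecture.HodgeConjecture.Cruxes.H413.F0P3cXiCentralIotaOfOrgans (XiCentralCharSplitLetter)
open Summit.HodgeConjecture.HodgeConjecture.Cruxes.H413.F0P3cXiCentralAllPlaces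
open Summit.HodgeConjecture.HodgeConjecture.Cruxes.H413.F0P3cXiCentralCharSplit (xiCentralCharSplit)

/-! ## §1 The two letters (PIN-τ verbatim; CASIMIR-τ = same frame, Casimir norm as conclusion) -/

/-- **LETTER PIN-τ** — the organ `S2PinCompactLetter` of the LH1 leaf `F0_P3c_S2SharpPaydown` ED. 2 «χ», restated BYTE-FOR-BYTE (same binders, same conclusion):
for a hol∕antihol cotangent `P` of `U(H)` with `K_c` acting trivially, in the ξ-family, `ξ` is of cohomological type with trivial coefficients at every
embedding `τ` not over the place of `ι`.  PRINT: `P ∈ Π′(ξ)`, at a compact place `Π′(ξ_τ) = {F_φ}`, `K_c`-triviality forces `F_φ = 𝟙`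
[Rogawski1990, §14.6 pp. 242–243 and Thm. 14.6.4 (p. 243); §12.3 p. 176; Thm. 13.3.5 (p. 202); §13.1 p. 199] [Liu2021, Remark 4.2]. -/
def S2PinCompactLetter : Prop :=
  ∀ (L : Type) [Field L] [NumberField L] [IsCMField L] (ι : L →+* ℂ) (H : Matrix (Fin 3) (Fin 3) L) (T : GL (Fin 3) ℂ)
    (hT : (T : Matrix (Fin 3) (Fin 3) ℂ)ᴴ * H.map ι * (T : Matrix (Fin 3) (Fin 3) ℂ) = Literature.Geometry.ComplexHyperbolic.BallModel.J),
    (∀ τ' : L →+* ℂ, InfinitePlace.mk τ' ≠ InfinitePlace.mk ι → (H.map τ').PosDef) →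
    2 ≤ Module.finrank ℚ ↥(maximalRealSubfield L) →
    ∀ (μ : Measure (adelicGroupData (↥(maximalRealSubfield L)) L (IsCMField.complexConj L) 3 H).automorphicQuotient)
      [(adelicGroupData (↥(maximalRealSubfield L)) L (IsCMField.complexConj L) 3 H).IsAutomorphicMeasure μ]
      (μω : HeckeCharacter L) (hμu : μω.IsUnitary),
      (∀ x : Literature.NumberTheory.GaloisRepresentations.ideleGroup ↥(maximalRealSubfield L),
        μω (AdeleRing.ideleBaseChange (↥(maximalRealSubfield L)) L x) = quadraticHeckeCharCM L x) →
    ∀ (P : DiscreteAutomorphicRep (adelicGroupData (↥(maximalRealSubfield L)) L (IsCMField.complexConj L) 3 H) μ),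
      (P.IsHolCotangentAt (cmArchSection L ι H T hT) (cmCompactFactor L ι H T hT) ∨
        P.IsAntiholCotangentAt (cmArchSection L ι H T hT) (cmCompactFactor L ι H T hT)) →
      (∀ k : (adelicGroupData (↥(maximalRealSubfield L)) L (IsCMField.complexConj L) 3 H).Adelic, k ∈ cmCompactFactor L ι H T hT →
        ∀ v : P.space.toSubmodule, (adelicGroupData (↥(maximalRealSubfield L)) L (IsCMField.complexConj L) 3 H).rightRegular μ k
          (v : (adelicGroupData (↥(maximalRealSubfield L)) L (IsCMField.complexConj L) 3 H).L2 μ) = v) →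
      ∀ ξ : OneDimAutRepH L,
        MemXiFamily P (transpose_map_cmConjRingHom_eq_of_frame L ι H T hT) (isUnit_det_of_frame L ι H T hT) μω hμu ξ →
          ∀ τ : L →+* ℂ, InfinitePlace.mk τ ≠ InfinitePlace.mk ι →
            ξ.IsCohTrivialAt (ArchSignRecipe.tOfArchType (archTypeOfRecord μω) τ) τ

/-- **LETTER CASIMIR-τ** — the PIN-τ frame with the conclusion replaced by the Casimir∕infinitesimal-character norm at the compact places: for every embedding
`τ` not over the place of `ι` and `(a,b,c) = rogTriple (pη τ) (qψ τ) t_τ`, `a² + b² + c² = 2`.  Modulo the in-house CENTRAL-τ identity `a + b + c = 0` this is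
the honest print residue «`qψ τ = ±1`» (packet rigidity) [Rogawski1990, Thm. 13.3.5 (p. 202); §14.6 Thm. 14.6.4 (p. 243); §12.3 p. 178] [BorelWallach2000, II Prop. 6.12]. -/
def S2CasimirTauLetter : Prop :=
  ∀ (L : Type) [Field L] [NumberField L] [IsCMField L] (ι : L →+* ℂ) (H : Matrix (Fin 3) (Fin 3) L) (T : GL (Fin 3) ℂ)
    (hT : (T : Matrix (Fin 3) (Fin 3) ℂ)ᴴ * H.map ι * (T : Matrix (Fin 3) (Fin 3) ℂ) = Literature.Geometry.ComplexHyperbolic.BallModel.J),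
    (∀ τ' : L →+* ℂ, InfinitePlace.mk τ' ≠ InfinitePlace.mk ι → (H.map τ').PosDef) →
    2 ≤ Module.finrank ℚ ↥(maximalRealSubfield L) →
    ∀ (μ : Measure (adelicGroupData (↥(maximalRealSubfield L)) L (IsCMField.complexConj L) 3 H).automorphicQuotient)
      [(adelicGroupData (↥(maximalRealSubfield L)) L (IsCMField.complexConj L) 3 H).IsAutomorphicMeasure μ]
      (μω : HeckeCharacter L) (hμu : μω.IsUnitary),
      (∀ x : Literature.NumberTheory.GaloisRepresentations.ideleGroup ↥(maximalRealSubfield L),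
        μω (AdeleRing.ideleBaseChange (↥(maximalRealSubfield L)) L x) = quadraticHeckeCharCM L x) →
    ∀ (P : DiscreteAutomorphicRep (adelicGroupData (↥(maximalRealSubfield L)) L (IsCMField.complexConj L) 3 H) μ),
      (P.IsHolCotangentAt (cmArchSection L ι H T hT) (cmCompactFactor L ι H T hT) ∨
        P.IsAntiholCotangentAt (cmArchSection L ι H T hT) (cmCompactFactor L ι H T hT)) →
      (∀ k : (adelicGroupData (↥(maximalRealSubfield L)) L (IsCMField.complexConj L) 3 H).Adelic, k ∈ cmCompactFactor L ι H T hT →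
        ∀ v : P.space.toSubmodule, (adelicGroupData (↥(maximalRealSubfield L)) L (IsCMField.complexConj L) 3 H).rightRegular μ k
          (v : (adelicGroupData (↥(maximalRealSubfield L)) L (IsCMField.complexConj L) 3 H).L2 μ) = v) →
      ∀ ξ : OneDimAutRepH L,
        MemXiFamily P (transpose_map_cmConjRingHom_eq_of_frame L ι H T hT) (isUnit_det_of_frame L ι H T hT) μω hμu ξ →
          ∀ τ : L →+* ℂ, InfinitePlace.mk τ ≠ InfinitePlace.mk ι →
            ∀ a b c : ℤ, ArchSignRecipe.rogTriple (ξ.pη τ) (ξ.qψ τ) (ArchSignRecipe.tOfArchType (archTypeOfRecord μω) τ) = (a, b, c) →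
              a ^ 2 + b ^ 2 + c ^ 2 = 2

/-! ## §2 PIN at `τ` ⟺ CASIMIR at `τ`, unconditionally (★ p850069's residue arithmetic with its O-SPLIT hypothesis discharged by ★ p850109) -/

section Frame

variable (L : Type) [Field L] [NumberField L] [IsCMField L] (ι : L →+* ℂ) (H : Matrix (Fin 3) (Fin 3) L) (T : GL (Fin 3) ℂ)
  (hT : (T : Matrix (Fin 3) (Fin 3) ℂ)ᴴ * H.map ι * (T : Matrix (Fin 3) (Fin 3) ℂ) = Literature.Geometry.ComplexHyperbolic.BallModel.J)
  (hdef : ∀ τ' : L →+* ℂ, InfinitePlace.mk τ' ≠ InfinitePlace.mk ι → (H.map τ').PosDef)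
  (h2 : 2 ≤ Module.finrank ℚ ↥(maximalRealSubfield L))
  (μ : Measure (adelicGroupData (↥(maximalRealSubfield L)) L (IsCMField.complexConj L) 3 H).automorphicQuotient)
  [(adelicGroupData (↥(maximalRealSubfield L)) L (IsCMField.complexConj L) 3 H).IsAutomorphicMeasure μ]
  (μω : HeckeCharacter L) (hμu : μω.IsUnitary)
  (hμω : ∀ x : Literature.NumberTheory.GaloisRepresentations.ideleGroup ↥(maximalRealSubfield L),
    μω (AdeleRing.ideleBaseChange (↥(maximalRealSubfield L)) L x) = quadraticHeckeCharCM L x)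
  (P : DiscreteAutomorphicRep (adelicGroupData (↥(maximalRealSubfield L)) L (IsCMField.complexConj L) 3 H) μ)
  (hP : P.IsHolCotangentAt (cmArchSection L ι H T hT) (cmCompactFactor L ι H T hT) ∨
    P.IsAntiholCotangentAt (cmArchSection L ι H T hT) (cmCompactFactor L ι H T hT))
  (ξ : OneDimAutRepH L)
  (hmem : MemXiFamily P (transpose_map_cmConjRingHom_eq_of_frame L ι H T hT) (isUnit_det_of_frame L ι H T hT) μω hμu ξ)

include hdef h2 hμω hP hmem

/-- **PIN at `τ` ⟺ CASIMIR at `τ`** for the triple of record — the two readings of the residue coincide. [cite: Rogawski1990, §12.3 p. 178] -/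
theorem isCohTrivialAt_iff_sq_sum_eq_two (τ : L →+* ℂ) (a b c : ℤ)
    (habc : ArchSignRecipe.rogTriple (ξ.pη τ) (ξ.qψ τ) (ArchSignRecipe.tOfArchType (archTypeOfRecord μω) τ) = (a, b, c)) :
    ξ.IsCohTrivialAt (ArchSignRecipe.tOfArchType (archTypeOfRecord μω) τ) τ ↔ a ^ 2 + b ^ 2 + c ^ 2 = 2 :=
  (isCohTrivialAt_iff_qψ_of_split xiCentralCharSplit L ι H T hT hdef h2 μ μω hμu hμω P hP ξ hmem τ).trans
    (sq_sum_eq_two_iff_qψ_of_split xiCentralCharSplit L ι H T hT hdef h2 μ μω hμu hμω P hP ξ hmem τ a b c habc).symm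

end Frame

/-! ## §3 The glue: PIN-τ ⟺ CASIMIR-τ as letters -/

/-- **(K1) «KOMPAKT-GLUE», forward: CASIMIR-τ ⇒ PIN-τ** — at a compact `τ` the Casimir norm `a²+b²+c² = 2` gives `qψ τ = ±1` (§2), hence the cohomological-weight
condition (★ `isCohTrivialAt_of_split_of_qψ`); the `K_c`-triviality binder of the frame is not used. [cite: Rogawski1990, §12.3 p. 176 and p. 178; §14.6 pp. 242–243] -/
theorem pinCompact_of_casimirTau (hC : S2CasimirTauLetter) : S2PinCompactLetter := by
  intro L _ _ _ ι H T hT hdef h2 μ _ μω hμu hμω P hP hKc ξ hmem τ hτ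
  have hq := (sq_sum_eq_two_iff_qψ_of_split xiCentralCharSplit L ι H T hT hdef h2 μ μω hμu hμω P hP ξ hmem τ _ _ _ rfl).mp
    (hC L ι H T hT hdef h2 μ μω hμu hμω P hP hKc ξ hmem τ hτ _ _ _ rfl)
  exact isCohTrivialAt_of_split_of_qψ xiCentralCharSplit L ι H T hT hdef h2 μ μω hμu hμω P hP ξ hmem τ hq

/-- **(K1) «KOMPAKT-GLUE», backward: PIN-τ ⇒ CASIMIR-τ** — coh-trivial at `τ` gives `qψ τ = ±1` (§2), hence the Casimir norm for every presentation `(a,b,c)` of the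
triple. [cite: Rogawski1990, §12.3 p. 178] -/
theorem casimirTau_of_pinCompact (hPin : S2PinCompactLetter) : S2CasimirTauLetter := by
  intro L _ _ _ ι H T hT hdef h2 μ _ μω hμu hμω P hP hKc ξ hmem τ hτ a b c habc
  have hq := (isCohTrivialAt_iff_qψ_of_split xiCentralCharSplit L ι H T hT hdef h2 μ μω hμu hμω P hP ξ hmem τ).mp
    (hPin L ι H T hT hdef h2 μ μω hμu hμω P hP hKc ξ hmem τ hτ)
  exact (sq_sum_eq_two_iff_qψ_of_split xiCentralCharSplit L ι H T hT hdef h2 μ μω hμu hμω P hP ξ hmem τ a b c habc).mpr hq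

/-- **(K1) «KOMPAKT-GLUE»: PIN-τ ⟺ CASIMIR-τ** — the compact-place pin of #80 and the compact-place Casimir norm are the same statement modulo the ★ in-house
CENTRAL-τ identity; what remains in print is exactly «`qψ τ = ±1`» [Thm. 13.3.5, Thm. 14.6.4]. [cite: Rogawski1990, §12.3 pp. 176–178; §14.6 pp. 242–243] -/
theorem pinCompact_iff_casimirTau : S2PinCompactLetter ↔ S2CasimirTauLetter :=
  ⟨casimirTau_of_pinCompact, pinCompact_of_casimirTau⟩

end Summit.HodgeConjecture.HodgeConjecture.Cruxes.H413.F0P3cPinCompactChi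

end
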